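import Literature.NumberTheory.Automorphic.OrdinaryCompletedCohomologyGL
import Literature.NumberTheory.Automorphic.HidaTowerHeckeCommutative
import Mathlib.NumberTheory.Padics.Complex
import Mathlib.Data.FunLike.Fintype
import HarnessLib

/-!
# Stub `stub_slopeZeroFactorisation` of the line `top-degree-exact-control` (crux
# `SkinnerWilesDefectOne.ProModularOrdinaryClassical`, stmt-Langlands-12921)

**Slope-zero points of the big Hecke algebra of the Hida tower of `GL₂` factor through the ordinary
Hecke algebra** (Khare–Thorne, Amer. J. Math. 139 (2017), §2.4, Lemma 2.10, in the tree's model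
`Literature/NumberTheory/Automorphic/OrdinaryCompletedCohomologyGL.lean`).  For a number field `F`, a
prime `p`, a tame level `𝒰 : TameLevel 2 F p` maximal above `p` whose Hida-tower cohomology groups
`H^i(X_{U(r)}, ℤ/p^s) = 𝒰.hidaCohomology ℤ (i, r, s)` are all finite, and a CONTINUOUS point
`y : 𝕋^S(𝒰; p) = HidaHeckeAlgebraGLn 𝒰 → ℚ̄_p` with `y(U_{v,1})^{m!} → 1` at every `v ∣ p`
(`IsSlopeZeroAt`), there is a continuous `x : 𝕋^{S,ord}(𝒰) = OrdinaryHeckeAlgebraGLn 𝒰 → ℚ̄_p` with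
`x ∘ toOrd = y`.

Proof (everything proved here from the tree's definitions, Mathlib, and the commutativity file
`HidaTowerHeckeCommutative`; no named fact):

1. `compactSpace_hidaHeckeAlgebraGLn`: each factor `End(H^i(X_{U(r)}, ℤ/p^s))` is finite and discrete,
   so `∏ End` is compact (Tychonoff) and the closed subring `𝕋^S(𝒰; p)` is compact.
2. `toOrd_surjective`: the image of `toOrd` is compact, hence closed in the Hausdorff `∏ End(H^{ord})`,
   and contains the generators of `𝕋^{S,ord}(𝒰)`, hence is everything.
3. `exists_tendsto_pow_factorial`: for `U ∈ 𝕋^S(𝒰; p)`, Hida's idempotent exists levelwise in the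
   finite monoids `End(H)` (`exists_isIdempotentElem_forall_pow_factorial_eq`), so `U^{m!}` converges
   (coordinatewise eventually constant) to some `e ∈ 𝕋^S(𝒰; p)` with `U_ι^{m!} = e_ι` for `m ≫ 0`.
4. `exists_idempotent_at`: for `U = U_{v,1}`, continuity of `y` and the slope-zero hypothesis give
   `y(e_v) = lim y(U_{v,1})^{m!} = 1`, and `e_{v,ι} H = ⋂_m U_{v,1,ι}^m H`
   (`range_eq_iInf_range_pow_of_forall_pow_factorial_eq`).
5. `exists_prod_idempotent`: the product `e = ∏_{v ∣ p} e_v` (the algebra is commutative for `GL₂`,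
   `HidaHeckeAlgebraGLn.mul_comm_of_isMaximalAbove`) has `y(e) = 1` and `e_ι H ⊆ ⋂_v ⋂_m U_{v,1,ι}^m H`,
   which is the ordinary part (`ordinaryPart_eq_iInf_range`).
6. `map_eq_zero_of_toOrd_eq_zero`: if `toOrd T = 0` then `T_ι` kills the ordinary part, so `T e = 0`
   and `y(T) = y(T) y(e) = y(T e) = 0`; i.e. `ker toOrd ≤ ker y`.
7. The stub: `x := y ∘ toOrd⁻¹` (`RingHom.liftOfRightInverse`); `toOrd` is a continuous surjection
   from a compact space onto a Hausdorff space, hence a quotient map, so `x` is continuous.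
[cite: KhareThorne2017, §2.4, Lemma 2.10]
-/

namespace Summit.Langlands.Langlands.Theorems.SkinnerWilesDefectOne.SlopeZeroFactorisation

set_option linter.dupNamespace false -- `Summit.Langlands.Langlands` is the mandated namespace

open Literature.NumberTheory.Automorphic Literature.NumberTheory.Automorphic.BigHeckeGLn
open NumberField IsDedekindDomain Filter Topology

noncomputable section

variable {F : Type} [Field F] [NumberField F] {p : ℕ} [Fact p.Prime] (𝒰 : TameLevel 2 F p)

/-- If `H^i(X_{U(r)}, ℤ/p^s)` is finite then so is its endomorphism ring (the factor of the product
in which `𝕋^S(𝒰; p)` lives). [folklore] -/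
theorem finite_hidaEndFactor (hfin : ∀ ι : TowerIndex, Finite (𝒰.hidaCohomology ℤ ι))
    (ι : TowerIndex) : Finite (𝒰.HidaEndFactor ℤ ι) := by
  haveI := hfin ι
  exact DFunLike.finite (𝒰.HidaEndFactor ℤ ι)

/-- **`𝕋^S(𝒰; p)` is compact** when all the `H^i(X_{U(r)}, ℤ/p^s)` are finite: a closed subring of a
product of finite discrete rings (Tychonoff). [folklore] -/
theorem compactSpace_hidaHeckeAlgebraGLn (hfin : ∀ ι : TowerIndex, Finite (𝒰.hidaCohomology ℤ ι)) :
    CompactSpace (HidaHeckeAlgebraGLn 𝒰) := by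
  haveI : ∀ ι : TowerIndex, CompactSpace (𝒰.HidaEndFactor ℤ ι) := fun ι =>
    haveI := finite_hidaEndFactor 𝒰 hfin ι
    inferInstance
  have hcl : IsClosed (𝒰.hidaHeckeSubring ℤ : Set (𝒰.hidaEndProd ℤ)) :=
    Subring.isClosed_topologicalClosure _
  exact isCompact_iff_compactSpace.1 hcl.isCompact

/-- **`toOrd : 𝕋^S(𝒰; p) → 𝕋^{S,ord}(𝒰)` is surjective** when all the `H^i(X_{U(r)}, ℤ/p^s)` are
finite: its image is compact, hence closed in the Hausdorff ring `∏ End(H^{ord})`, and it is a subring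
containing the generators of `𝕋^{S,ord}(𝒰)` (the closure of the subring they generate). [folklore] -/
theorem toOrd_surjective (hfin : ∀ ι : TowerIndex, Finite (𝒰.hidaCohomology ℤ ι)) :
    Function.Surjective (𝒰.toOrd ℤ) := by
  haveI := compactSpace_hidaHeckeAlgebraGLn 𝒰 hfin
  let f : HidaHeckeAlgebraGLn 𝒰 →+* 𝒰.ordEndProd ℤ := (𝒰.ordHeckeSubring ℤ).subtype.comp (𝒰.toOrd ℤ)
  have hfc : Continuous f := continuous_subtype_val.comp (𝒰.continuous_toOrd ℤ)
  have hclosed : IsClosed (f.range : Set (𝒰.ordEndProd ℤ)) := by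
    rw [RingHom.coe_range]
    exact (isCompact_range hfc).isClosed
  have hle : 𝒰.ordHeckeSubring ℤ ≤ f.range := by
    refine Subring.topologicalClosure_minimal _ (Subring.closure_le.2 ?_) hclosed
    rintro _ ⟨g, hg, rfl⟩
    exact ⟨𝒰.hidaOp hg, rfl⟩
  intro z
  obtain ⟨T, hT⟩ := RingHom.mem_range.1 (hle z.2)
  exact ⟨T, Subtype.ext hT⟩

/-- **Hida's idempotent of an element of `𝕋^S(𝒰; p)`** (finite cohomology): for `U ∈ 𝕋^S(𝒰; p)` the
sequence `U^{m!}` converges in `𝕋^S(𝒰; p)` to an element `e`, and at every index `ι = (i, r, s)` one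
has `U_ι^{m!} = e_ι` for all large `m` (Hida's idempotent exists in the finite monoid `End(H)`,
`exists_isIdempotentElem_forall_pow_factorial_eq`; the product topology is that of coordinatewise
convergence and `𝕋^S(𝒰; p)` is closed). [cite: KhareThorne2017, §2.4, Lemma 2.10] -/
theorem exists_tendsto_pow_factorial (hfin : ∀ ι : TowerIndex, Finite (𝒰.hidaCohomology ℤ ι))
    (U : HidaHeckeAlgebraGLn 𝒰) :
    ∃ e : HidaHeckeAlgebraGLn 𝒰, Tendsto (fun m : ℕ => U ^ m.factorial) atTop (𝓝 e) ∧
      ∀ ι : TowerIndex, ∃ N : ℕ, ∀ m : ℕ, N ≤ m →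
        (U : 𝒰.hidaEndProd ℤ) ι ^ m.factorial = (e : 𝒰.hidaEndProd ℤ) ι := by
  haveI := fun ι => finite_hidaEndFactor 𝒰 hfin ι
  choose e _hidem N hN using fun ι : TowerIndex =>
    exists_isIdempotentElem_forall_pow_factorial_eq ((U : 𝒰.hidaEndProd ℤ) ι)
  have hlim : Tendsto (fun m : ℕ => (U : 𝒰.hidaEndProd ℤ) ^ m.factorial) atTop (𝓝 e) :=
    tendsto_pi_nhds.2 fun ι => tendsto_atTop_of_eventually_const (i₀ := N ι) fun m hm => by
      show ((U : 𝒰.hidaEndProd ℤ) ^ m.factorial) ι = e ι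
      rw [Pi.pow_apply]
      exact hN ι m hm
  have hcl : IsClosed (𝒰.hidaHeckeSubring ℤ : Set (𝒰.hidaEndProd ℤ)) :=
    Subring.isClosed_topologicalClosure _
  have hmem : e ∈ 𝒰.hidaHeckeSubring ℤ :=
    hcl.mem_of_tendsto hlim (Eventually.of_forall fun m => by
      simpa only [Subring.coe_pow, SetLike.mem_coe] using (U ^ m.factorial).2)
  refine ⟨⟨e, hmem⟩, ?_, fun ι => ⟨N ι, hN ι⟩⟩
  rw [tendsto_subtype_rng]
  simpa only [Subring.coe_pow] using hlim

variable (y : HidaHeckeAlgebraGLn 𝒰 →+* PadicAlgCl p)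

/-- **`y(e_v) = 1` and `e_v H = ⋂_m U_{v,1}^m H`.** For a continuous point `y` of slope zero at
`v ∣ p`, the limit `e_v = lim U_{v,1}^{m!} ∈ 𝕋^S(𝒰; p)` satisfies `y(e_v) = lim y(U_{v,1})^{m!} = 1`, and
at every index its range lies in `U_{v,1}^m H` for every `m`
(`range_eq_iInf_range_pow_of_forall_pow_factorial_eq`). [cite: KhareThorne2017, §2.4, Lemma 2.10] -/
theorem exists_idempotent_at (hfin : ∀ ι : TowerIndex, Finite (𝒰.hidaCohomology ℤ ι))
    (hy : Continuous y) {v : HeightOneSpectrum (𝓞 F)} (hv : (p : 𝓞 F) ∈ v.asIdeal)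
    (hslope : 𝒰.IsSlopeZeroAt y v) :
    ∃ e : HidaHeckeAlgebraGLn 𝒰, y e = 1 ∧
      ∀ (ι : TowerIndex) (z : 𝒰.hidaCohomology ℤ ι) (m : ℕ),
        (e : 𝒰.hidaEndProd ℤ) ι z ∈ LinearMap.range (TameLevel.HidaEndFactor.toEnd 𝒰 ℤ
          (𝒰.hidaFamily ℤ (heckeElement 2 F v 1) ι ^ m)) := by
  obtain ⟨e, hlim, hN⟩ := exists_tendsto_pow_factorial 𝒰 hfin (𝒰.hidaT v 1)
  refine ⟨e, ?_, fun ι z m => ?_⟩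
  · have h1 : Tendsto (fun m : ℕ => y (𝒰.hidaT v 1) ^ m.factorial) atTop (𝓝 (y e)) := by
      simpa only [Function.comp_def, map_pow] using (hy.tendsto e).comp hlim
    exact tendsto_nhds_unique h1 (hslope 1 le_rfl (by norm_num))
  · obtain ⟨N, hN⟩ := hN ι
    rw [𝒰.coe_hidaT (Or.inr hv) 1] at hN
    have hrange : LinearMap.range (TameLevel.HidaEndFactor.toEnd 𝒰 ℤ ((e : 𝒰.hidaEndProd ℤ) ι)) =
        ⨅ m : ℕ, LinearMap.range (TameLevel.HidaEndFactor.toEnd 𝒰 ℤ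
          (𝒰.hidaFamily ℤ (heckeElement 2 F v 1) ι ^ m)) :=
      range_eq_iInf_range_pow_of_forall_pow_factorial_eq hN
    exact (Submodule.mem_iInf _).1 (hrange.le (LinearMap.mem_range_self _ z)) m

/-- **The product of the idempotents over a finite set of places above `p`.** For `𝒰` maximal above
`p` (so that `𝕋^S(𝒰; p)` is commutative, `HidaHeckeAlgebraGLn.mul_comm_of_isMaximalAbove`) and a
continuous point `y` of slope zero above `p`, for every finite set `s` of places above `p` there is
`e ∈ 𝕋^S(𝒰; p)` (namely `∏_{v ∈ s} e_v`) with `y(e) = 1` whose range at every index lies in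
`U_{v,1}^m H` for all `v ∈ s` and all `m`. [cite: KhareThorne2017, §2.4, Lemma 2.10] -/
theorem exists_prod_idempotent (h𝒰 : 𝒰.IsMaximalAbove)
    (hfin : ∀ ι : TowerIndex, Finite (𝒰.hidaCohomology ℤ ι)) (hy : Continuous y)
    (hslope : ∀ v : HeightOneSpectrum (𝓞 F), (p : 𝓞 F) ∈ v.asIdeal → 𝒰.IsSlopeZeroAt y v)
    (s : Finset (HeightOneSpectrum (𝓞 F))) (hs : ∀ v ∈ s, (p : 𝓞 F) ∈ v.asIdeal) :
    ∃ e : HidaHeckeAlgebraGLn 𝒰, y e = 1 ∧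
      ∀ v ∈ s, ∀ (ι : TowerIndex) (z : 𝒰.hidaCohomology ℤ ι) (m : ℕ),
        (e : 𝒰.hidaEndProd ℤ) ι z ∈ LinearMap.range (TameLevel.HidaEndFactor.toEnd 𝒰 ℤ
          (𝒰.hidaFamily ℤ (heckeElement 2 F v 1) ι ^ m)) := by
  classical
  induction s using Finset.induction_on with
  | empty => exact ⟨1, map_one y, fun v hv => absurd hv (Finset.notMem_empty v)⟩
  | insert a s _ ih =>
    obtain ⟨e', he'1, he'⟩ := ih fun v hv => hs v (Finset.mem_insert_of_mem hv)
    have ha : (p : 𝓞 F) ∈ a.asIdeal := hs a (Finset.mem_insert_self a s)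
    obtain ⟨e, he1, he⟩ := exists_idempotent_at 𝒰 y hfin hy ha (hslope a ha)
    refine ⟨e * e', by rw [map_mul, he1, he'1, mul_one], fun v hv ι z m => ?_⟩
    rcases Finset.mem_insert.1 hv with rfl | hv
    · exact he ι ((e' : 𝒰.hidaEndProd ℤ) ι z) m
    · rw [HidaHeckeAlgebraGLn.mul_comm_of_isMaximalAbove h𝒰 e e']
      exact he' v hv ι ((e : 𝒰.hidaEndProd ℤ) ι z) m

/-- **`ker toOrd ≤ ker y` for a continuous slope-zero point `y`** (`𝒰` maximal above `p`, finite
cohomology): with `e = ∏_{v ∣ p} e_v`, the range of `e_ι` lies in the ordinary part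
`H^{ord} = ⋂_{v ∣ p} ⋂_m U_{v,1,ι}^m H` (`ordinaryPart_eq_iInf_range`), so `toOrd T = 0` forces
`T e = 0` and `y(T) = y(T) y(e) = y(T e) = 0`. [cite: KhareThorne2017, §2.4, Lemma 2.10] -/
theorem map_eq_zero_of_toOrd_eq_zero (h𝒰 : 𝒰.IsMaximalAbove)
    (hfin : ∀ ι : TowerIndex, Finite (𝒰.hidaCohomology ℤ ι)) (hy : Continuous y)
    (hslope : ∀ v : HeightOneSpectrum (𝓞 F), (p : 𝓞 F) ∈ v.asIdeal → 𝒰.IsSlopeZeroAt y v)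
    {T : HidaHeckeAlgebraGLn 𝒰} (hT : 𝒰.toOrd ℤ T = 0) : y T = 0 := by
  obtain ⟨e, he1, he⟩ := exists_prod_idempotent 𝒰 y h𝒰 hfin hy hslope
    (BigHeckeGLn.finite_setOf_natCast_mem_asIdeal F p).toFinset (fun v hv => by simpa using hv)
  -- the range of `e` lies in the ordinary parts
  have hord : ∀ (ι : TowerIndex) (z : 𝒰.hidaCohomology ℤ ι),
      (e : 𝒰.hidaEndProd ℤ) ι z ∈ 𝒰.ordinaryPart ℤ ι := by
    intro ι z
    rw [𝒰.ordinaryPart_eq_iInf_range h𝒰 ℤ ι]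
    simp only [Submodule.mem_iInf]
    rintro ⟨v, hv⟩ j m
    have hj : j.val + 1 = 1 := by have := j.isLt; omega
    rw [hj]
    exact he v (by simpa using hv) ι z m
  -- hence `T e = 0`
  have hTe : T * e = 0 := by
    refine Subtype.ext (funext fun ι => DFunLike.ext _ _ fun z => ?_)
    have h1 := congrArg (fun S : OrdinaryHeckeAlgebraGLn 𝒰 =>
      ((S : 𝒰.ordEndProd ℤ) ι ⟨_, hord ι z⟩ : 𝒰.hidaCohomology ℤ ι)) hT
    exact h1
  calc y T = y T * y e := by rw [he1, mul_one]
    _ = 0 := by rw [← map_mul, hTe, map_zero]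

end

end Summit.Langlands.Langlands.Theorems.SkinnerWilesDefectOne.SlopeZeroFactorisation

namespace Summit.Langlands.Langlands.Cruxes.ProModularOrdinaryClassical.TopDegreeExactControl

set_option linter.dupNamespace false -- `Summit.Langlands.Langlands` is the mandated namespace

open Summit.Langlands.Langlands.Theorems.SkinnerWilesDefectOne.SlopeZeroFactorisation
open Literature.NumberTheory.Automorphic Literature.NumberTheory.Automorphic.BigHeckeGLn
open NumberField IsDedekindDomain Filter Topology

/-- **Stub 2 of the line `top-degree-exact-control` — slope-zero factorisation (Khare–Thorne,
Lemma 2.10, for the tree's big Hecke algebras of the Hida tower of `GL₂`).** For `𝒰` maximal above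
`p` with finite Hida-tower cohomology, every continuous point `y : 𝕋^S(𝒰; p) → ℚ̄_p` of slope zero at
every `v ∣ p` factors as `y = x ∘ toOrd` with `x : 𝕋^{S,ord}(𝒰) → ℚ̄_p` continuous: `ker toOrd ≤ ker y`
(`map_eq_zero_of_toOrd_eq_zero`), `toOrd` is surjective (`toOrd_surjective`), and a continuous
surjection from a compact space onto a Hausdorff space is a quotient map. See the module docstring.
[cite: KhareThorne2017, §2.4, Lemma 2.10] -/
theorem stub_slopeZeroFactorisation : ∀ (F : Type) [Field F] [NumberField F] (p : ℕ) [Fact p.Prime] (𝒰 : Literature.NumberTheory.Automorphic.BigHeckeGLn.TameLevel 2 F p), 𝒰.IsMaximalAbove → (∀ ι : Literature.NumberTheory.Automorphic.TowerIndex, Finite (𝒰.hidaCohomology ℤ ι)) → ∀ (y : Literature.NumberTheory.Automorphic.HidaHeckeAlgebraGLn 𝒰 →+* PadicAlgCl p), Continuous y → (∀ v : IsDedekindDomain.HeightOneSpectrum (NumberField.RingOfIntegers F), (p : NumberField.RingOfIntegers F) ∈ v.asIdeal → 𝒰.IsSlopeZeroAt y v) → ∃ x : Literature.NumberTheory.Automorphic.OrdinaryHeckeAlgebraGLn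 𝒰 →+* PadicAlgCl p, Continuous x ∧ x.comp (𝒰.toOrd ℤ) = y := by
  intro F _ _ p _ 𝒰 h𝒰 hfin y hy hslope
  have hsurj : Function.Surjective (𝒰.toOrd ℤ) := toOrd_surjective 𝒰 hfin
  have hker : RingHom.ker (𝒰.toOrd ℤ) ≤ RingHom.ker y := fun T hT =>
    (RingHom.mem_ker).2 (map_eq_zero_of_toOrd_eq_zero 𝒰 y h𝒰 hfin hy hslope ((RingHom.mem_ker).1 hT))
  obtain ⟨x, hx⟩ : ∃ x : OrdinaryHeckeAlgebraGLn 𝒰 →+* PadicAlgCl p, x.comp (𝒰.toOrd ℤ) = y :=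
    ⟨(𝒰.toOrd ℤ).liftOfRightInverse (Function.surjInv hsurj) (Function.rightInverse_surjInv hsurj)
        ⟨y, hker⟩,
      RingHom.liftOfRightInverse_comp _ _ _ _⟩
  refine ⟨x, ?_, hx⟩
  haveI := compactSpace_hidaHeckeAlgebraGLn 𝒰 hfin
  have hq : Topology.IsQuotientMap (𝒰.toOrd ℤ) :=
    Topology.IsQuotientMap.of_surjective_continuous hsurj (𝒰.continuous_toOrd ℤ)
  rw [hq.continuous_iff, ← RingHom.coe_comp, hx]
  exact hy

end Summit.Langlands.Langlands.Cruxes.ProModularOrdinaryClassical.TopDegreeExactControl
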